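import Summits.RiemannHypothesis.RiemannHypothesis.Theorems.JensenPolynomialsSkewFarSolve
import Summits.RiemannHypothesis.RiemannHypothesis.Theorems.JensenPolynomialsSkewFarDeltaTwo

/-!
# Route `JensenPolynomials`, FAR crux `XiCumulantSkew98Far` — part 6a: the three normalised moments of `U = u⁻²`
(RH-FREE; cell rh-jensen, HUMAN RULING D-0040)

For `s ≥ 4·10¹⁸`, `a = a_s`, `Z = M_s`, `m_j = M_{s−2j}` (so `E_s[U^j] = m_j/Z`, `U = u⁻²`), `R = 4A + s/a²`, `κ = c/R`:
combining the solved Stein system (part 4b) with the delta method (parts 5a/5b) gives the dimensionless centred moments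

  `P := a³R·(m₁/Z − a⁻²)`,  `Q := a⁶R·(m₂/Z − 2a⁻²m₁/Z + a⁻⁴)`,  `T := a⁹R²·(m₃/Z − 3a⁻²m₂/Z + 3a⁻⁴m₁/Z − a⁻⁶)`

(`= a³R·E[D]`, `a⁶R·E[D²]`, `a⁹R²·E[D³]`, `D = U − a⁻²`) to the precision
`|P − (2κ + 3/a)| ≤ 0.011`, `|Q − 4| ≤ 10⁻⁴`, `|T − (40κ + 108/a)| ≤ 0.2` (`P_bound`, `Q_bound`, `T_bound`).
WHAT THIS IS NOT: nothing here bears on the zeros of `ζ`. References: Stein's method, delta method (folklore); [GORZPNAS2019].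
-/

noncomputable section
-- D-0017: `Summit.RiemannHypothesis.RiemannHypothesis.…` duplicates the namespace BY DESIGN (single-problem summit).
set_option linter.dupNamespace false

namespace Summit.RiemannHypothesis.RiemannHypothesis.Theorems.JensenPolynomials.SkewFar

open Literature.NumberTheory.LFunctions Literature.Probability.Distributions MeasureTheory Set Filter Real
open scoped Topology Nat

/-- `R ≥ 10¹⁷` (from `R a²/s ≥ 4a + 1` and `s ≥ 10¹² a⁶`). -/
theorem R_large (s : ℕ) (hs : 4 * 10 ^ 18 ≤ s) {A R c : ℝ} (hA : A = 4 * π * exp (4 * xiMode (s : ℝ)))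
    (hR : R = 4 * A + s / xiMode (s : ℝ) ^ 2) (hc : c = 8 * A - s / xiMode (s : ℝ) ^ 3) : 1e17 ≤ R := by
  obtain ⟨ha0, ha, _, _⟩ := mode_facts s hs
  obtain ⟨_, _, _, hR0, _, _, hRω1, _⟩ := consts_facts s hs hA hR hc
  have h6 := pow_six_le s hs
  set a := xiMode (s : ℝ) with ha_def
  have hs' : (4 * 10 ^ 18 : ℝ) ≤ (s : ℝ) := by exact_mod_cast hs
  have hspos : (0 : ℝ) < s := by linarith
  have h1 : (4 * a + 1) * s ≤ R * a ^ 2 := by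
    have := (le_div_iff₀ hspos).1 hRω1; linarith
  have ha4 : (7974 : ℝ) ≤ a ^ 4 := by
    have h := pow_le_pow_left₀ (by norm_num) ha 4; norm_num at h; linarith
  have ha2 : 0 < a ^ 2 := by positivity
  -- `R a² ≥ 38.8 s ≥ 38.8·10¹² a⁶` ⇒ `R ≥ 38.8·10¹² a⁴`
  have h2 : 38.8 * (10 ^ 12 * a ^ 6) ≤ R * a ^ 2 := by nlinarith
  have h3 : 38.8 * 10 ^ 12 * a ^ 4 ≤ R := by
    have e : 38.8 * (10 ^ 12 * a ^ 6) = (38.8 * 10 ^ 12 * a ^ 4) * a ^ 2 := by ring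
    rw [e] at h2
    exact le_of_mul_le_mul_right h2 ha2
  nlinarith

/-- Algebra for `P_main`: `P − main = (a³R/Z)·LHS₁`. -/
theorem alg_P {Z a R P M2 I1 I2 I3 : ℝ} (hZ : Z ≠ 0) (ha : a ≠ 0) (hR : R ≠ 0)
    (hP : P = a ^ 3 * R * (M2 / Z - 1 / a ^ 2)) :
    P - (-2 * (R * (I1 / Z)) + 3 * (R * (I2 / Z)) / a - 4 * (R ^ 2 * (I3 / Z)) / (a ^ 2 * R)) =
      a ^ 3 * R / Z * (M2 - Z / a ^ 2 - (-2 * I1 / a + 3 * I2 / a ^ 2 - 4 * I3 / a ^ 3) / a ^ 2) := by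
  rw [hP]
  field_simp

/-- Algebra for `P_main`: the error term in normalised moments. -/
theorem alg_E1 {Z a R l x₄ z₃ : ℝ} (hZ : Z ≠ 0) (ha : a ≠ 0) (hl : l ≠ 0) :
    a ^ 3 * R / Z * ((2 / a) ^ 2 * ((5 + 2 * (l / a)) / a ^ 4 * (x₄ * Z) + 2 / (l / a * a ^ 6) * (z₃ * Z)) +
      9 * (a / 2 / (a / 2) ^ 2 * ((4 / a) ^ 7 * (z₃ * Z)))) =
      R * ((4 * (5 + 2 * (l / a)) / a ^ 3) * x₄ + (8 / (l * a ^ 4)) * z₃ + (294912 / a ^ 5) * z₃) := by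
  field_simp
  ring

/-- Algebra for `P_main`: the error term after the a-priori bounds. -/
theorem alg_E1b {a l : ℝ} (ha : a ≠ 0) (hl : l ≠ 0) :
    (4.11 * (a / l ^ 2)) * ((4 * (5 + 2 * (l / a)) / a ^ 3) * (3 * l ^ 4) + (8 / (l * a ^ 4)) * (15 * l ^ 6) +
      (294912 / a ^ 5) * (15 * l ^ 6)) = 4.11 * (60 * (l ^ 2 / a ^ 2) + 144 * (l ^ 3 / a ^ 3) +
      4423680 * (l ^ 2 * l ^ 2 / a ^ 4)) := by
  field_simp
  ring

set_option maxHeartbeats 400000 in -- long `field_simp; ring` bookkeeping, no search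
/-- **P, delta-method part**: `|P − (−2y₁ + 3y₂/a − 4y₃/(a²R))| ≤ 10⁻⁶` (`y₁ = R x₁`, `y₂ = R x₂`, `y₃ = R² x₃`). -/
theorem P_main (s : ℕ) (hs : 4 * 10 ^ 18 ≤ s) {A R c P : ℝ} (hA : A = 4 * π * exp (4 * xiMode (s : ℝ)))
    (hR : R = 4 * A + s / xiMode (s : ℝ) ^ 2) (hc : c = 8 * A - s / xiMode (s : ℝ) ^ 3)
    (hP : P = xiMode (s : ℝ) ^ 3 * R * (xiMoment (s - 2) / xiMoment s - 1 / xiMode (s : ℝ) ^ 2)) :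
    |P - (-2 * (R * ((∫ u in Ioi 0, deBruijnPhi u * u ^ s * (u - xiMode (s : ℝ))) / xiMoment s)) +
      3 * (R * (xiAbsMoment s 2 (xiMode (s : ℝ)) / xiMoment s)) / xiMode (s : ℝ) -
      4 * (R ^ 2 * ((∫ u in Ioi 0, deBruijnPhi u * u ^ s * (u - xiMode (s : ℝ)) ^ 3) / xiMoment s)) /
        (xiMode (s : ℝ) ^ 2 * R))| ≤ 1e-6 := by
  obtain ⟨ha0, ha, _, _⟩ := mode_facts s hs
  obtain ⟨_, _, _, hR0, hc0, _, _, _⟩ := consts_facts s hs hA hR hc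
  obtain ⟨hl0, _, hmu2, hmu, hlb⟩ := scale_facts s hs (l := xiMode (s : ℝ) / Real.sqrt s) rfl
  obtain ⟨hRle, _, _, _, _⟩ := const_sizes s hs hA hR hc (l := xiMode (s : ℝ) / Real.sqrt s) rfl
  obtain ⟨hl2b, hl3b, _, _, _, _, _, _, hl22, _, _⟩ := monomials s hs (l := xiMode (s : ℝ) / Real.sqrt s) rfl
  obtain ⟨⟨_, hz20, hz30, _, _⟩, _, hz2, hz3, _, _⟩ :=
    z_bounds s hs (l := xiMode (s : ℝ) / Real.sqrt s) rfl rfl rfl rfl rfl rfl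
  have hJ := J1_bound s hs (lam := xiMode (s : ℝ) / Real.sqrt s / xiMode (s : ℝ)) (by positivity)
  set a := xiMode (s : ℝ) with ha_def
  set l : ℝ := a / Real.sqrt s with hl
  set Z := xiMoment s with hZdef
  have hZ : 0 < Z := xiMoment_pos s
  set I1 := ∫ u in Ioi 0, deBruijnPhi u * u ^ s * (u - a)
  set I3 := ∫ u in Ioi 0, deBruijnPhi u * u ^ s * (u - a) ^ 3
  set x₄ := xiAbsMoment s 4 a / Z
  set z₃ := xiAbsMoment s 6 a / Z
  have hI4 : xiAbsMoment s 4 a = x₄ * Z := (div_mul_cancel₀ (xiAbsMoment s 4 a) hZ.ne').symm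
  have hI6 : xiAbsMoment s 6 a = z₃ * Z := (div_mul_cancel₀ (xiAbsMoment s 6 a) hZ.ne').symm
  -- `P − main = (a³R/Z)·LHS₁`
  have e : P - (-2 * (R * (I1 / Z)) + 3 * (R * (xiAbsMoment s 2 a / Z)) / a - 4 * (R ^ 2 * (I3 / Z)) / (a ^ 2 * R)) =
      a ^ 3 * R / Z * (xiMoment (s - 2) - Z / a ^ 2 -
        (-2 * I1 / a + 3 * xiAbsMoment s 2 a / a ^ 2 - 4 * I3 / a ^ 3) / a ^ 2) :=
    alg_P hZ.ne' ha0.ne' hR0.ne' hP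
  rw [e, abs_mul, abs_of_pos (by positivity)]
  have h1 := mul_le_mul_of_nonneg_left hJ (show 0 ≤ a ^ 3 * R / Z by positivity)
  refine h1.trans ?_
  rw [hI4, hI6]
  have e2 : a ^ 3 * R / Z * ((2 / a) ^ 2 * ((5 + 2 * (l / a)) / a ^ 4 * (x₄ * Z) + 2 / (l / a * a ^ 6) * (z₃ * Z)) +
      9 * (a / 2 / (a / 2) ^ 2 * ((4 / a) ^ 7 * (z₃ * Z)))) =
      R * ((4 * (5 + 2 * (l / a)) / a ^ 3) * x₄ + (8 / (l * a ^ 4)) * z₃ + (294912 / a ^ 5) * z₃) :=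
    alg_E1 hZ.ne' ha0.ne' hl0.ne'
  rw [e2]
  have h2 : R * ((4 * (5 + 2 * (l / a)) / a ^ 3) * x₄ + (8 / (l * a ^ 4)) * z₃ + (294912 / a ^ 5) * z₃) ≤
      (4.11 * (a / l ^ 2)) * ((4 * (5 + 2 * (l / a)) / a ^ 3) * (3 * l ^ 4) + (8 / (l * a ^ 4)) * (15 * l ^ 6) +
        (294912 / a ^ 5) * (15 * l ^ 6)) := by
    gcongr
  refine h2.trans ?_
  have e3 : (4.11 * (a / l ^ 2)) * ((4 * (5 + 2 * (l / a)) / a ^ 3) * (3 * l ^ 4) + (8 / (l * a ^ 4)) * (15 * l ^ 6) +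
      (294912 / a ^ 5) * (15 * l ^ 6)) = 4.11 * (60 * (l ^ 2 / a ^ 2) + 144 * (l ^ 3 / a ^ 3) +
      4423680 * (l ^ 2 * l ^ 2 / a ^ 4)) := alg_E1b ha0.ne' hl0.ne'
  rw [e3]
  have ha1 : (1 : ℝ) ≤ a := by linarith
  have d1 : l ^ 2 / a ^ 2 ≤ l ^ 2 := div_le_self (by positivity) (one_le_pow₀ ha1)
  have d2 : l ^ 3 / a ^ 3 ≤ l ^ 3 := div_le_self (by positivity) (one_le_pow₀ ha1)
  have d3 : l ^ 2 * l ^ 2 / a ^ 4 ≤ l ^ 2 * l ^ 2 := div_le_self (by positivity) (one_le_pow₀ ha1)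
  linarith

set_option maxHeartbeats 400000 in -- long interval bookkeeping, no search
/-- **P.** `|a³R·E[D] − (2κ + 3/a)| ≤ 0.011`. -/
theorem P_bound (s : ℕ) (hs : 4 * 10 ^ 18 ≤ s) {A R c P : ℝ} (hA : A = 4 * π * exp (4 * xiMode (s : ℝ)))
    (hR : R = 4 * A + s / xiMode (s : ℝ) ^ 2) (hc : c = 8 * A - s / xiMode (s : ℝ) ^ 3)
    (hP : P = xiMode (s : ℝ) ^ 3 * R * (xiMoment (s - 2) / xiMoment s - 1 / xiMode (s : ℝ) ^ 2)) :
    |P - (2 * (c / R) + 3 / xiMode (s : ℝ))| ≤ 0.011 := by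
  obtain ⟨ha0, ha, _, _⟩ := mode_facts s hs
  obtain ⟨_, _, _, hR0, hc0, _, _, _⟩ := consts_facts s hs hA hR hc
  obtain ⟨hy2, hy1, hy4, hy3, hκ1, hκ2⟩ := solve s hs hA hR hc (x₁ := _) (x₂ := _) (x₃ := _) (x₄ := _) rfl rfl rfl rfl
  have hRbig := R_large s hs hA hR hc
  have hmain := P_main s hs hA hR hc hP
  set a := xiMode (s : ℝ) with ha_def
  set Z := xiMoment s with hZdef
  set I1 := ∫ u in Ioi 0, deBruijnPhi u * u ^ s * (u - a)
  set I3 := ∫ u in Ioi 0, deBruijnPhi u * u ^ s * (u - a) ^ 3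
  -- `main − (2κ + 3/a)`
  have hrest : |-2 * (R * (I1 / Z)) + 3 * (R * (xiAbsMoment s 2 a / Z)) / a - 4 * (R ^ 2 * (I3 / Z)) / (a ^ 2 * R) -
      (2 * (c / R) + 3 / a)| ≤ 0.0105 := by
    have t1 : |-2 * (R * (I1 / Z) + c / R)| ≤ 2 * 0.0051 := by
      rw [abs_mul, abs_neg, abs_of_pos (by norm_num : (0:ℝ) < 2)]; linarith
    have t2 : |3 * (R * (xiAbsMoment s 2 a / Z) - 1) / a| ≤ 3 * 1e-5 / (189 / 20) := by
      rw [abs_div, abs_mul, abs_of_pos (by norm_num : (0:ℝ) < 3), abs_of_pos ha0]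
      exact div_le_div₀ (by norm_num) (by linarith) (by norm_num) ha
    have t3 : |4 * (R ^ 2 * (I3 / Z)) / (a ^ 2 * R)| ≤ 4 * 10.02 / ((189 / 20) ^ 2 * 1e17) := by
      rw [abs_div, abs_mul, abs_of_pos (by norm_num : (0:ℝ) < 4), abs_of_pos (mul_pos (pow_pos ha0 2) hR0)]
      have h3 : |R ^ 2 * (I3 / Z)| ≤ 10.02 := by
        have h := abs_le.1 hy3
        rw [abs_le]; constructor <;> linarith [h.1, h.2]
      exact div_le_div₀ (by norm_num) (by linarith) (by norm_num)
        (mul_le_mul (pow_le_pow_left₀ (by norm_num) ha 2) hRbig (by norm_num) (by positivity))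
    have esplit : -2 * (R * (I1 / Z)) + 3 * (R * (xiAbsMoment s 2 a / Z)) / a - 4 * (R ^ 2 * (I3 / Z)) / (a ^ 2 * R) -
        (2 * (c / R) + 3 / a) = -2 * (R * (I1 / Z) + c / R) + 3 * (R * (xiAbsMoment s 2 a / Z) - 1) / a -
        4 * (R ^ 2 * (I3 / Z)) / (a ^ 2 * R) := by
      field_simp; ring
    rw [esplit]
    calc |-2 * (R * (I1 / Z) + c / R) + 3 * (R * (xiAbsMoment s 2 a / Z) - 1) / a - 4 * (R ^ 2 * (I3 / Z)) / (a ^ 2 * R)|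
        ≤ |-2 * (R * (I1 / Z) + c / R)| + |3 * (R * (xiAbsMoment s 2 a / Z) - 1) / a| +
            |4 * (R ^ 2 * (I3 / Z)) / (a ^ 2 * R)| := by
          refine (abs_sub _ _).trans ?_; gcongr; exact abs_add_le _ _
      _ ≤ 2 * 0.0051 + 3 * 1e-5 / (189 / 20) + 4 * 10.02 / ((189 / 20) ^ 2 * 1e17) := by linarith
      _ ≤ 0.0105 := by norm_num
  calc |P - (2 * (c / R) + 3 / a)|
      ≤ |P - (-2 * (R * (I1 / Z)) + 3 * (R * (xiAbsMoment s 2 a / Z)) / a - 4 * (R ^ 2 * (I3 / Z)) / (a ^ 2 * R))| +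
          |-2 * (R * (I1 / Z)) + 3 * (R * (xiAbsMoment s 2 a / Z)) / a - 4 * (R ^ 2 * (I3 / Z)) / (a ^ 2 * R) -
            (2 * (c / R) + 3 / a)| := abs_sub_le _ _ _
    _ ≤ 1e-6 + 0.0105 := add_le_add hmain hrest
    _ ≤ 0.011 := by norm_num

/-! ## Q -/

/-- Algebra for `Q_main`: `Q − 4Rx₂ = (a⁶R/Z)·LHS₂`. -/
theorem alg_Q {Z a R Q M2 M4 I2 : ℝ} (hZ : Z ≠ 0) (ha : a ≠ 0)
    (hQ : Q = a ^ 6 * R * (M4 / Z - 2 * M2 / (a ^ 2 * Z) + 1 / a ^ 4)) :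
    Q - 4 * (R * (I2 / Z)) = a ^ 6 * R / Z * (M4 - 2 * M2 / a ^ 2 + Z / a ^ 4 - 4 * I2 / a ^ 6) := by
  rw [hQ]
  field_simp

/-- Algebra for `Q_main`: the error term in normalised moments. -/
theorem alg_E2 {Z a R l x₂ x₄ z₃ : ℝ} (hZ : Z ≠ 0) (ha : a ≠ 0) (hl : l ≠ 0) :
    a ^ 6 * R / Z * ((2 / a) ^ 4 * (6 * (l / a) / a ^ 2 * (x₂ * Z) + (6 / (l / a) + 23 + 8 * (l / a)) / a ^ 4 * (x₄ * Z) +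
        (8 / (l / a) + 4) / a ^ 6 * (z₃ * Z)) + 55 * (a / 2 / (a / 2) ^ 4 * ((4 / a) ^ 7 * (z₃ * Z)))) =
      R * (96 * (l / a) * x₂ + 16 * (6 * a / l + 23 + 8 * l / a) / a ^ 2 * x₄ +
        (16 * (8 * a / l + 4) + 7208960) / a ^ 4 * z₃) := by
  field_simp
  ring

/-- Algebra for `Q_main`: after the a-priori bounds. -/
theorem alg_E2b {a l : ℝ} (ha : a ≠ 0) (hl : l ≠ 0) :
    (4.11 * (a / l ^ 2)) * (96 * (l / a) * l ^ 2 + 16 * (6 * a / l + 23 + 8 * l / a) / a ^ 2 * (3 * l ^ 4) +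
        (16 * (8 * a / l + 4) + 7208960) / a ^ 4 * (15 * l ^ 6)) =
      4.11 * (384 * l + 1104 * (l ^ 2 / a) + 2304 * (l ^ 3 / a ^ 2) + 108135360 * (l ^ 2 * l ^ 2 / a ^ 3)) := by
  field_simp
  ring

set_option maxHeartbeats 400000 in -- long interval bookkeeping, no search
/-- **Q.** `|a⁶R·E[D²] − 4| ≤ 10⁻⁴`. -/
theorem Q_bound (s : ℕ) (hs : 4 * 10 ^ 18 ≤ s) {A R c Q : ℝ} (hA : A = 4 * π * exp (4 * xiMode (s : ℝ)))
    (hR : R = 4 * A + s / xiMode (s : ℝ) ^ 2) (hc : c = 8 * A - s / xiMode (s : ℝ) ^ 3)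
    (hQ : Q = xiMode (s : ℝ) ^ 6 * R *
      (xiMoment (s - 4) / xiMoment s - 2 * xiMoment (s - 2) / (xiMode (s : ℝ) ^ 2 * xiMoment s) + 1 / xiMode (s : ℝ) ^ 4)) :
    |Q - 4| ≤ 1e-4 := by
  obtain ⟨ha0, ha, _, _⟩ := mode_facts s hs
  obtain ⟨_, _, _, hR0, hc0, _, _, _⟩ := consts_facts s hs hA hR hc
  obtain ⟨hl0, _, hmu2, hmu, hlb⟩ := scale_facts s hs (l := xiMode (s : ℝ) / Real.sqrt s) rfl
  obtain ⟨hRle, _, _, _, _⟩ := const_sizes s hs hA hR hc (l := xiMode (s : ℝ) / Real.sqrt s) rfl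
  obtain ⟨hl2b, hl3b, _, _, _, _, _, _, hl22, _, _⟩ := monomials s hs (l := xiMode (s : ℝ) / Real.sqrt s) rfl
  obtain ⟨⟨hz10, hz20, hz30, _, _⟩, hz1, hz2, hz3, _, _⟩ :=
    z_bounds s hs (l := xiMode (s : ℝ) / Real.sqrt s) rfl rfl rfl rfl rfl rfl
  obtain ⟨hy2, _, _, _, _, _⟩ := solve s hs hA hR hc (x₁ := _) (x₂ := _) (x₃ := _) (x₄ := _) rfl rfl rfl rfl
  have hJ := J2_bound s hs (lam := xiMode (s : ℝ) / Real.sqrt s / xiMode (s : ℝ)) (by positivity)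
  set a := xiMode (s : ℝ) with ha_def
  set l : ℝ := a / Real.sqrt s with hl
  set Z := xiMoment s with hZdef
  have hZ : 0 < Z := xiMoment_pos s
  set x₂ := xiAbsMoment s 2 a / Z
  set x₄ := xiAbsMoment s 4 a / Z
  set z₃ := xiAbsMoment s 6 a / Z
  have hI2 : xiAbsMoment s 2 a = x₂ * Z := (div_mul_cancel₀ (xiAbsMoment s 2 a) hZ.ne').symm
  have hI4 : xiAbsMoment s 4 a = x₄ * Z := (div_mul_cancel₀ (xiAbsMoment s 4 a) hZ.ne').symm
  have hI6 : xiAbsMoment s 6 a = z₃ * Z := (div_mul_cancel₀ (xiAbsMoment s 6 a) hZ.ne').symm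
  have e : Q - 4 * (R * x₂) = a ^ 6 * R / Z *
      (xiMoment (s - 4) - 2 * xiMoment (s - 2) / a ^ 2 + Z / a ^ 4 - 4 * xiAbsMoment s 2 a / a ^ 6) :=
    alg_Q hZ.ne' ha0.ne' hQ
  have hmain : |Q - 4 * (R * x₂)| ≤ 6e-5 := by
    rw [e, abs_mul, abs_of_pos (by positivity)]
    have h1 := mul_le_mul_of_nonneg_left hJ (show 0 ≤ a ^ 6 * R / Z by positivity)
    refine h1.trans ?_
    rw [hI2, hI4, hI6, alg_E2 hZ.ne' ha0.ne' hl0.ne']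
    have h2 : R * (96 * (l / a) * x₂ + 16 * (6 * a / l + 23 + 8 * l / a) / a ^ 2 * x₄ +
        (16 * (8 * a / l + 4) + 7208960) / a ^ 4 * z₃) ≤
        (4.11 * (a / l ^ 2)) * (96 * (l / a) * l ^ 2 + 16 * (6 * a / l + 23 + 8 * l / a) / a ^ 2 * (3 * l ^ 4) +
        (16 * (8 * a / l + 4) + 7208960) / a ^ 4 * (15 * l ^ 6)) := by
      gcongr
    refine h2.trans ?_
    rw [alg_E2b ha0.ne' hl0.ne']
    have ha1 : (1 : ℝ) ≤ a := by linarith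
    have d1 : l ^ 2 / a ≤ l ^ 2 := div_le_self (by positivity) ha1
    have d2 : l ^ 3 / a ^ 2 ≤ l ^ 3 := div_le_self (by positivity) (one_le_pow₀ ha1)
    have d3 : l ^ 2 * l ^ 2 / a ^ 3 ≤ l ^ 2 * l ^ 2 := div_le_self (by positivity) (one_le_pow₀ ha1)
    linarith
  have e2 : Q - 4 = (Q - 4 * (R * x₂)) + 4 * (R * x₂ - 1) := by ring
  rw [e2]
  calc |Q - 4 * (R * x₂) + 4 * (R * x₂ - 1)| ≤ |Q - 4 * (R * x₂)| + |4 * (R * x₂ - 1)| := abs_add_le _ _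
    _ ≤ 6e-5 + 4 * 1e-5 := by
        rw [abs_mul, abs_of_pos (by norm_num : (0:ℝ) < 4)]
        exact add_le_add hmain (by linarith)
    _ ≤ 1e-4 := by norm_num

/-! ## T -/

/-- Algebra for `T_bound`: `T − (−8R²x₃ + 36R²x₄/a) = (a⁹R²/Z)·LHS₃`. -/
theorem alg_T {Z a R T M2 M4 M6 I3 I4 : ℝ} (hZ : Z ≠ 0) (ha : a ≠ 0)
    (hT : T = a ^ 9 * R ^ 2 * (M6 / Z - 3 * M4 / (a ^ 2 * Z) + 3 * M2 / (a ^ 4 * Z) - 1 / a ^ 6)) :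
    T - (-8 * (R ^ 2 * (I3 / Z)) + 36 * (R ^ 2 * (I4 / Z)) / a) =
      a ^ 9 * R ^ 2 / Z * (M6 - 3 * M4 / a ^ 2 + 3 * M2 / a ^ 4 - Z / a ^ 6 - (-8 * I3 / a ^ 3 + 36 * I4 / a ^ 4) / a ^ 6) := by
  rw [hT]
  field_simp

/-- Algebra for `T_bound`: the error term in normalised moments. -/
theorem alg_E3 {Z a R l x₄ z₃ z₄ z₅ : ℝ} (hZ : Z ≠ 0) (ha : a ≠ 0) (hl : l ≠ 0) :
    a ^ 9 * R ^ 2 / Z * ((2 / a) ^ 6 * (51 * (l / a) / a ^ 4 * (x₄ * Z) +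
        (51 / (l / a) + 381 + 300 * (l / a)) / a ^ 6 * (z₃ * Z) +
        (300 / (l / a) + 492 + 104 * (l / a)) / a ^ 8 * (z₄ * Z) + (104 / (l / a) + 36) / a ^ 10 * (z₅ * Z)) +
        1819 * (a / 2 / (a / 2) ^ 6 * ((4 / a) ^ 7 * (z₃ * Z)))) =
      R ^ 2 * (3264 * (l / a ^ 2) * x₄ + (64 * (51 * a / l + 381 + 300 * l / a) + 953679872) / a ^ 3 * z₃ +
        64 * (300 * a / l + 492 + 104 * l / a) / a ^ 5 * z₄ + 64 * (104 * a / l + 36) / a ^ 7 * z₅) := by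
  field_simp
  ring

/-- Algebra for `T_bound`: after the a-priori bounds. -/
theorem alg_E3b {a l : ℝ} (ha : a ≠ 0) (hl : l ≠ 0) :
    (4.11 * (a / l ^ 2)) ^ 2 * (3264 * (l / a ^ 2) * (3 * l ^ 4) +
        (64 * (51 * a / l + 381 + 300 * l / a) + 953679872) / a ^ 3 * (15 * l ^ 6) +
        64 * (300 * a / l + 492 + 104 * l / a) / a ^ 5 * (105 * l ^ 8) + 64 * (104 * a / l + 36) / a ^ 7 * (945 * l ^ 10)) =
      16.8921 * (58752 * l + 14305563840 * (l ^ 2 / a) + 2304000 * (l ^ 3 / a ^ 2) + 3306240 * (l ^ 4 / a ^ 3) +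
        6988800 * (l ^ 5 / a ^ 4) + 2177280 * (l ^ 6 / a ^ 5)) := by
  field_simp
  ring

set_option maxHeartbeats 400000 in -- long interval bookkeeping, no search
/-- **T.** `|a⁹R²·E[D³] − (40κ + 108/a)| ≤ 0.2`. -/
theorem T_bound (s : ℕ) (hs : 4 * 10 ^ 18 ≤ s) {A R c T : ℝ} (hA : A = 4 * π * exp (4 * xiMode (s : ℝ)))
    (hR : R = 4 * A + s / xiMode (s : ℝ) ^ 2) (hc : c = 8 * A - s / xiMode (s : ℝ) ^ 3)
    (hT : T = xiMode (s : ℝ) ^ 9 * R ^ 2 *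
      (xiMoment (s - 6) / xiMoment s - 3 * xiMoment (s - 4) / (xiMode (s : ℝ) ^ 2 * xiMoment s) +
        3 * xiMoment (s - 2) / (xiMode (s : ℝ) ^ 4 * xiMoment s) - 1 / xiMode (s : ℝ) ^ 6)) :
    |T - (40 * (c / R) + 108 / xiMode (s : ℝ))| ≤ 0.2 := by
  obtain ⟨ha0, ha, _, _⟩ := mode_facts s hs
  obtain ⟨_, _, _, hR0, hc0, _, _, _⟩ := consts_facts s hs hA hR hc
  obtain ⟨hl0, _, hmu2, hmu, hlb⟩ := scale_facts s hs (l := xiMode (s : ℝ) / Real.sqrt s) rfl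
  obtain ⟨hRle, _, _, _, _⟩ := const_sizes s hs hA hR hc (l := xiMode (s : ℝ) / Real.sqrt s) rfl
  obtain ⟨hl2b, hl3b, _, _, _, _, _, _, hl22, _, _⟩ := monomials s hs (l := xiMode (s : ℝ) / Real.sqrt s) rfl
  obtain ⟨⟨_, hz20, hz30, hz40, hz50⟩, _, hz2, hz3, hz4, hz5⟩ :=
    z_bounds s hs (l := xiMode (s : ℝ) / Real.sqrt s) rfl rfl rfl rfl rfl rfl
  obtain ⟨_, _, hy4, hy3, _, _⟩ := solve s hs hA hR hc (x₁ := _) (x₂ := _) (x₃ := _) (x₄ := _) rfl rfl rfl rfl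
  have hJ := J3_bound s hs (lam := xiMode (s : ℝ) / Real.sqrt s / xiMode (s : ℝ)) (by positivity)
  set a := xiMode (s : ℝ) with ha_def
  set l : ℝ := a / Real.sqrt s with hl
  set Z := xiMoment s with hZdef
  have hZ : 0 < Z := xiMoment_pos s
  set I3 := ∫ u in Ioi 0, deBruijnPhi u * u ^ s * (u - a) ^ 3
  set x₄ := xiAbsMoment s 4 a / Z
  set z₃ := xiAbsMoment s 6 a / Z
  set z₄ := xiAbsMoment s 8 a / Z
  set z₅ := xiAbsMoment s 10 a / Z
  have hI4 : xiAbsMoment s 4 a = x₄ * Z := (div_mul_cancel₀ (xiAbsMoment s 4 a) hZ.ne').symm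
  have hI6 : xiAbsMoment s 6 a = z₃ * Z := (div_mul_cancel₀ (xiAbsMoment s 6 a) hZ.ne').symm
  have hI8 : xiAbsMoment s 8 a = z₄ * Z := (div_mul_cancel₀ (xiAbsMoment s 8 a) hZ.ne').symm
  have hI10 : xiAbsMoment s 10 a = z₅ * Z := (div_mul_cancel₀ (xiAbsMoment s 10 a) hZ.ne').symm
  have e : T - (-8 * (R ^ 2 * (I3 / Z)) + 36 * (R ^ 2 * x₄) / a) = a ^ 9 * R ^ 2 / Z *
      (xiMoment (s - 6) - 3 * xiMoment (s - 4) / a ^ 2 + 3 * xiMoment (s - 2) / a ^ 4 - Z / a ^ 6 -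
        (-8 * I3 / a ^ 3 + 36 * xiAbsMoment s 4 a / a ^ 4) / a ^ 6) :=
    alg_T hZ.ne' ha0.ne' hT
  have hmain : |T - (-8 * (R ^ 2 * (I3 / Z)) + 36 * (R ^ 2 * x₄) / a)| ≤ 0.013 := by
    rw [e, abs_mul, abs_of_pos (by positivity)]
    have h1 := mul_le_mul_of_nonneg_left hJ (show 0 ≤ a ^ 9 * R ^ 2 / Z by positivity)
    refine h1.trans ?_
    rw [hI4, hI6, hI8, hI10, alg_E3 hZ.ne' ha0.ne' hl0.ne']
    have hR2 : R ^ 2 ≤ (4.11 * (a / l ^ 2)) ^ 2 := pow_le_pow_left₀ hR0.le hRle 2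
    have h2 : R ^ 2 * (3264 * (l / a ^ 2) * x₄ + (64 * (51 * a / l + 381 + 300 * l / a) + 953679872) / a ^ 3 * z₃ +
        64 * (300 * a / l + 492 + 104 * l / a) / a ^ 5 * z₄ + 64 * (104 * a / l + 36) / a ^ 7 * z₅) ≤
        (4.11 * (a / l ^ 2)) ^ 2 * (3264 * (l / a ^ 2) * (3 * l ^ 4) +
        (64 * (51 * a / l + 381 + 300 * l / a) + 953679872) / a ^ 3 * (15 * l ^ 6) +
        64 * (300 * a / l + 492 + 104 * l / a) / a ^ 5 * (105 * l ^ 8) + 64 * (104 * a / l + 36) / a ^ 7 * (945 * l ^ 10)) := by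
      gcongr
    refine h2.trans ?_
    rw [alg_E3b ha0.ne' hl0.ne']
    have ha1 : (1 : ℝ) ≤ a := by linarith
    have hl1 : l ≤ 1 := by linarith
    have d1 : l ^ 2 / a ≤ l ^ 2 := div_le_self (by positivity) ha1
    have d2 : l ^ 3 / a ^ 2 ≤ l ^ 3 := div_le_self (by positivity) (one_le_pow₀ ha1)
    have d3 : l ^ 4 / a ^ 3 ≤ l ^ 3 := by
      calc l ^ 4 / a ^ 3 ≤ l ^ 4 := div_le_self (by positivity) (one_le_pow₀ ha1)
        _ = l ^ 3 * l := by ring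
        _ ≤ l ^ 3 * 1 := mul_le_mul_of_nonneg_left hl1 (by positivity)
        _ = l ^ 3 := mul_one _
    have d4 : l ^ 5 / a ^ 4 ≤ l ^ 3 := by
      calc l ^ 5 / a ^ 4 ≤ l ^ 5 := div_le_self (by positivity) (one_le_pow₀ ha1)
        _ = l ^ 3 * l ^ 2 := by ring
        _ ≤ l ^ 3 * 1 := mul_le_mul_of_nonneg_left (pow_le_one₀ hl0.le hl1) (by positivity)
        _ = l ^ 3 := mul_one _
    have d5 : l ^ 6 / a ^ 5 ≤ l ^ 3 := by
      calc l ^ 6 / a ^ 5 ≤ l ^ 6 := div_le_self (by positivity) (one_le_pow₀ ha1)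
        _ = l ^ 3 * l ^ 3 := by ring
        _ ≤ l ^ 3 * 1 := mul_le_mul_of_nonneg_left (pow_le_one₀ hl0.le hl1) (by positivity)
        _ = l ^ 3 := mul_one _
    linarith
  have e2 : T - (40 * (c / R) + 108 / a) = (T - (-8 * (R ^ 2 * (I3 / Z)) + 36 * (R ^ 2 * x₄) / a)) -
      8 * (R ^ 2 * (I3 / Z) + 5 * (c / R)) + 36 * (R ^ 2 * x₄ - 3) / a := by
    field_simp; ring
  rw [e2]
  have t2 : |8 * (R ^ 2 * (I3 / Z) + 5 * (c / R))| ≤ 8 * 0.02 := by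
    rw [abs_mul, abs_of_pos (by norm_num : (0:ℝ) < 8)]; linarith
  have t3 : |36 * (R ^ 2 * x₄ - 3) / a| ≤ 36 * 1e-3 / (189 / 20) := by
    rw [abs_div, abs_mul, abs_of_pos (by norm_num : (0:ℝ) < 36), abs_of_pos ha0]
    exact div_le_div₀ (by norm_num) (by linarith) (by norm_num) ha
  calc |T - (-8 * (R ^ 2 * (I3 / Z)) + 36 * (R ^ 2 * x₄) / a) - 8 * (R ^ 2 * (I3 / Z) + 5 * (c / R)) +
        36 * (R ^ 2 * x₄ - 3) / a|
      ≤ |T - (-8 * (R ^ 2 * (I3 / Z)) + 36 * (R ^ 2 * x₄) / a) - 8 * (R ^ 2 * (I3 / Z) + 5 * (c / R))| +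
          |36 * (R ^ 2 * x₄ - 3) / a| := abs_add_le _ _
    _ ≤ |T - (-8 * (R ^ 2 * (I3 / Z)) + 36 * (R ^ 2 * x₄) / a)| + |8 * (R ^ 2 * (I3 / Z) + 5 * (c / R))| +
          |36 * (R ^ 2 * x₄ - 3) / a| := by gcongr; exact abs_sub _ _
    _ ≤ 0.013 + 8 * 0.02 + 36 * 1e-3 / (189 / 20) := by linarith
    _ ≤ 0.2 := by norm_num

end Summit.RiemannHypothesis.RiemannHypothesis.Theorems.JensenPolynomials.SkewFar

end
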